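import Literature.Analysis.FluidPDE.WholeSpacePressureL3
import Literature.Analysis.FluidPDE.NormalisedPressureLpBoundProofs
import HarnessLib

/-!
# The Riesz-transform pressure of an `L³` velocity field as a continuous operator `L³ → L^{3/2}`

Analysis/FluidPDE definition/proof file in the DAG below the named fact
`Literature.Analysis.FluidPDE.kato_distributional_slab` (**D** of `KatoLocalLerayPressure.lean`:
a mild `C([0,T); L³)` solution solves the Navier–Stokes equations in the sense of distributions
on the open slab with the Riesz pressure in `L^{3/2}`; Lemarié-Rieusset 2016, Def. 6.9 with
Prop. 6.2 and Prop. 6.5). The pressure of **D** is the whole-space pressure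
`Δp = -∂ᵢ∂ⱼ(uᵢuⱼ)` of the slices `u(t) ∈ L³`, and the proof of **D** needs it as a genuine
**operator** `w ↦ Π[w]` on `L³` — one fixed choice for every field, continuous from `L³` to
`L^{3/2}` (to make `(t, x) ↦ Π[u(t)](x)` jointly measurable along the continuous curve
`t ↦ u(t) ∈ L³`, and to pass to limits), agreeing a.e. on a.e.-equal fields, and satisfying the
weak Poisson equation. The tree's `exists_wholeSpacePressure_of_stein`
(`WholeSpacePressureL3.lean`, Seregin's `p₁`) provides, for each `U ∈ L³` separately, *some*
`P ∈ L^{3/2}` with the bound and the Poisson equation; this file upgrades that existence statement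
to the operator, by the same approximation argument (Tsai 1998, proof of Lemma 2.1, p. 34: "We
then extend this result to general `U ∈ L^q` by approximation") with the uniqueness of the
limit made explicit:

* `steinConstThreeHalves` — a choice of Stein's constant `C_{3/2}` in
  `‖p̃[w]‖_{L^{3/2}} ≤ C ‖|w|²‖_{L^{3/2}}` for test fields (the tree's proved
  `stein1970_normalisedPressure_Lp_bound_holds`, Stein 1970, Ch. II §4.2 Thm. 3), and the
  bilinear (polarisation) estimate for test fields at `(L³, L^{3/2})`
  (`eLpNorm_normalisedPressure_sub_le_three`, from the tree's `eLpNorm_normalisedPressure_sub_le`);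
* `IsRieszPressureOf w Q` — `w ∈ L³`, `Q ∈ L^{3/2}` and `p̃[vₙ] → Q` in `L^{3/2}` along **every**
  sequence of test fields `vₙ → w` in `L³`; existence for `w ∈ L³` (`exists_isRieszPressureOf`: Cauchy in
  `L^{3/2}` by the bilinear estimate, completeness, stability under change of the approximating
  sequence) and uniqueness a.e. (`IsRieszPressureOf.ae_eq`);
* `rieszPressure w = Π[w]` — the chosen Riesz pressure (junk `0` off `L³`, where no `Q` is a Riesz
  pressure since `w ∈ L³` is part of the predicate), with:
  `memLp_rieszPressure`, the bound `‖Π[w]‖_{L^{3/2}} ≤ C_{3/2} ‖w‖²_{L³}` (`eLpNorm_rieszPressure_le`),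
  the bilinear estimate on `L³` (`eLpNorm_rieszPressure_sub_le`) and hence the **continuity**
  `vₙ → w` in `L³` ⇒ `Π[vₙ] → Π[w]` in `L^{3/2}` (`tendsto_eLpNorm_rieszPressure_sub`), invariance
  under a.e. modification (`rieszPressure_congr_ae`), agreement with the normalised pressure
  `p̃[w]` of `NormalisedPressure.lean` for test fields (`rieszPressure_ae_eq_normalisedPressure`),
  and the **weak pressure Poisson equation** `∫ Π[w] Δφ = -∫ D²φ(w, w)` for every test function
  `φ` (`integral_rieszPressure_mul_laplacian`; Tsai 1998, (2.5)).

Sign convention: `Π[w]` is the limit of Tao's normalised pressure `p̃ = -Δ⁻¹∂ᵢ∂ⱼ(wᵢwⱼ)`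
(Tao 2011, (35)), i.e. `ΔΠ[w] = -∂ᵢ∂ⱼ(wᵢwⱼ)` — the Navier–Stokes pressure of the velocity `w`
(with `ℛⱼ = ∂ⱼ/√(-Δ)` as in Lemarié-Rieusset's Prop. 6.2 this is `+Σᵢⱼ ℛᵢℛⱼ(wᵢwⱼ)`).

## Mathlib / tree search

Tree (`lean search 'wholeSpacePressure|normalisedPressure_Lp_bound|RieszPressure'`):
`exists_wholeSpacePressure_of_stein`, `tendsto_integral_mul_of_tendsto_eLpNorm_sub`,
`tendsto_integral_hessian_apply_of_tendsto_eLpNorm`, `eLpNorm_norm_sq_eq_threeHalves`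
(`WholeSpacePressureL3.lean`, all reused); `exists_rieszPressure` (`NecasRuzickaSverakRiesz.lean`:
per-field existence for every exponent `1 < q < ∞` with the same bound and weak Poisson
equation — existence only, like `exists_wholeSpacePressure_of_stein`; the operator, its
a.e.-invariance and `L³ → L^{3/2}` continuity are what this file adds);
`eLpNorm_normalisedPressure_sub_le`,
`cauchy_of_quadratic_bound`, `exists_memLp_tendsto_eLpNorm_sub_of_cauchy`,
`exists_smooth_seq_tendsto_eLpNorm_withDensity`, `tendsto_eLpNorm_of_tendsto_eLpNorm_sub`,
`integral_normalisedPressure_mul_laplacian_eq_neg` (`TsaiWeightedRieszPressureProofs.lean`);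
`stein1970_normalisedPressure_Lp_bound_holds` (`NormalisedPressureLpBoundProofs.lean`);
`memLp_normalisedPressure_three_halves` (`NormalisedPressureCompactSupport.lean`). Mathlib: `Lp`
completeness (through the tree lemma), `eLpNorm_eq_zero_iff`, `MemLp.ae_eq`. No Riesz transforms
in Mathlib.

## References

* T.-P. Tsai, *On Leray's self-similar solutions of the Navier–Stokes equations satisfying local
  energy estimates*, Arch. Rational Mech. Anal. 143 (1998), Lemma 2.1 and its proof, (2.5)
  (p. 34). [Tsai1998]
* E. M. Stein, *Singular integrals and differentiability properties of functions* (1970),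
  Ch. II §4.2 Thm. 3, Ch. III §1. [Stein1971]
* P. G. Lemarié-Rieusset, *The Navier–Stokes problem in the 21st century*, CRC Press 2016,
  Prop. 6.2 (file p. 130), Def. 6.9 and Prop. 6.5 (p. 136). [LemarieRieusset2016]
* T. Tao, *Localisation and compactness properties of the Navier–Stokes global regularity
  problem*, Anal. PDE 6 (2013) = arXiv:1108.1165, (35). [Tao2011]
-/

noncomputable section

open MeasureTheory TopologicalSpace Set Function Filter Topology Metric
open scoped ENNReal NNReal RealInnerProductSpace Laplacian

namespace Literature.Analysis.FluidPDE

local notation "ℝ³" => EuclideanSpace ℝ (Fin 3)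

/-! ## Tools: test-field approximation in `L³` -/

section Tools

/-- **Test fields are dense in `L³(ℝ³; ℝ³)`**: every `w ∈ L³` is the `L³`-limit of smooth
compactly supported fields (the tree's `exists_smooth_seq_tendsto_eLpNorm_withDensity` with the
trivial weight `|x|⁰`). [folklore] -/
theorem exists_smooth_seq_tendsto_eLpNorm_three {w : ℝ³ → ℝ³} (hw : MemLp w 3 volume) :
    ∃ v : ℕ → ℝ³ → ℝ³, (∀ n, ContDiff ℝ (⊤ : ℕ∞) (v n) ∧ HasCompactSupport (v n)) ∧
      Tendsto (fun n => eLpNorm (v n - w) 3 volume) atTop (𝓝 0) := by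
  have h0 : (volume.withDensity fun x : ℝ³ => ‖x‖ₑ ^ (0 : ℝ)) = volume := by
    simp only [ENNReal.rpow_zero]
    exact withDensity_one
  have h := exists_smooth_seq_tendsto_eLpNorm_withDensity (G := ℝ³) (p := 3)
    (by norm_num : (-3 : ℝ) < 0) (by norm_num) ENNReal.ofNat_ne_top (U := w) (by rw [h0]; exact hw)
  rwa [h0] at h

end Tools

/-! ## Stein's bound at the exponent `3/2` and the bilinear estimate for test fields -/

section Stein

/-- **Stein's bound for the normalised pressure of test fields at `p = 3/2`** (the tree's proved
`stein1970_normalisedPressure_Lp_bound_holds`, Stein 1970, Ch. II §4.2 Thm. 3): there is `C`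
with `‖p̃[w]‖_{L^{3/2}} ≤ C ‖|w|²‖_{L^{3/2}} = C ‖w‖²_{L³}` for every `w ∈ C_c^∞(ℝ³; ℝ³)`.
[cite: Stein1971, Ch. II §4.2 Thm. 3] -/
theorem exists_stein_const_three_halves : ∃ C : ℝ≥0, ∀ w : ℝ³ → ℝ³, ContDiff ℝ (⊤ : ℕ∞) w →
    HasCompactSupport w → eLpNorm (normalisedPressure w) (3 / 2 : ℝ≥0∞) volume ≤
      C * eLpNorm (fun x => ‖w x‖ ^ 2) (3 / 2 : ℝ≥0∞) volume := by
  have h1 : (1 : ℝ≥0∞) < 3 / 2 :=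
    (ENNReal.lt_div_iff_mul_lt (Or.inl (by norm_num)) (Or.inl (by norm_num))).2 (by norm_num)
  have h2 : (3 / 2 : ℝ≥0∞) < ⊤ := (ENNReal.div_ne_top (by norm_num) (by norm_num)).lt_top
  exact stein1970_normalisedPressure_Lp_bound_holds (3 / 2) h1 h2

/-- **Stein's constant** `C_{3/2}` of `exists_stein_const_three_halves` (a choice). [folklore] -/
def steinConstThreeHalves : ℝ≥0 := exists_stein_const_three_halves.choose

/-- The defining bound of `C_{3/2}`: `‖p̃[w]‖_{L^{3/2}} ≤ C_{3/2} ‖|w|²‖_{L^{3/2}}` for test fields.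
[cite: Stein1971, Ch. II §4.2 Thm. 3] -/
theorem eLpNorm_normalisedPressure_le_steinConst {w : ℝ³ → ℝ³} (hw : ContDiff ℝ (⊤ : ℕ∞) w)
    (hwc : HasCompactSupport w) :
    eLpNorm (normalisedPressure w) (3 / 2 : ℝ≥0∞) volume ≤
      steinConstThreeHalves * eLpNorm (fun x => ‖w x‖ ^ 2) (3 / 2 : ℝ≥0∞) volume :=
  exists_stein_const_three_halves.choose_spec w hw hwc

/-- The same with `‖|w|²‖_{L^{3/2}} = ‖w‖²_{L³}`. [cite: Stein1971, Ch. II §4.2 Thm. 3] -/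
theorem eLpNorm_normalisedPressure_le_steinConst' {w : ℝ³ → ℝ³} (hw : ContDiff ℝ (⊤ : ℕ∞) w)
    (hwc : HasCompactSupport w) :
    eLpNorm (normalisedPressure w) (3 / 2 : ℝ≥0∞) volume ≤
      steinConstThreeHalves * eLpNorm w 3 volume ^ 2 := by
  rw [← eLpNorm_norm_sq_eq_threeHalves]
  exact eLpNorm_normalisedPressure_le_steinConst hw hwc

/-- **The bilinear estimate for test fields at `(L³, L^{3/2})`** (polarisation, the tree's
`eLpNorm_normalisedPressure_sub_le`; Tsai 1998, proof of Lemma 2.1): for every `t > 0`,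
`‖p̃[u] − p̃[v]‖_{L^{3/2}} ≤ 4 C_{3/2} (t² ‖u − v‖²_{L³} + t⁻² ‖u + v‖²_{L³})`.
[cite: Tsai1998, Lemma 2.1 proof (p. 34)] -/
theorem eLpNorm_normalisedPressure_sub_le_three {u v : ℝ³ → ℝ³} (hu : ContDiff ℝ (⊤ : ℕ∞) u)
    (huc : HasCompactSupport u) (hv : ContDiff ℝ (⊤ : ℕ∞) v) (hvc : HasCompactSupport v)
    {t : ℝ} (ht : 0 < t) :
    eLpNorm (normalisedPressure u - normalisedPressure v) (3 / 2 : ℝ≥0∞) volume ≤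
      4 * steinConstThreeHalves * (ENNReal.ofReal (t ^ 2) * eLpNorm (u - v) 3 volume ^ 2 +
        ENNReal.ofReal (t⁻¹ ^ 2) * eLpNorm (u + v) 3 volume ^ 2) := by
  have h1 : (1 : ℝ≥0∞) ≤ 3 / 2 :=
    ((ENNReal.lt_div_iff_mul_lt (Or.inl (by norm_num)) (Or.inl (by norm_num))).2 (by norm_num)).le
  have h := eLpNorm_normalisedPressure_sub_le (μ := volume) (p := (3 / 2 : ℝ≥0∞))
    (C := steinConstThreeHalves) (fun w hw hwc => eLpNorm_normalisedPressure_le_steinConst hw hwc)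
    h1 hu huc hv hvc ht
  rwa [eLpNorm_norm_sq_eq_threeHalves, eLpNorm_norm_sq_eq_threeHalves] at h

/-- **Convergence from the bilinear estimate** (pure `ℝ≥0∞` bookkeeping): if
`Dₙ ≤ A (t² Tₙ² + t⁻² Sₙ²)` for every `t > 0`, with `A < ∞`, `Tₙ → 0` and `Sₙ ≤ K < ∞` for all
`n`, then `Dₙ → 0`. [folklore] -/
theorem tendsto_zero_of_quadratic_bound {D T S : ℕ → ℝ≥0∞} {A K : ℝ≥0∞} (hA : A ≠ ⊤)
    (hK : K ≠ ⊤) (hT : Tendsto T atTop (𝓝 0)) (hS : ∀ n, S n ≤ K)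
    (hD : ∀ t : ℝ, 0 < t → ∀ n, D n ≤
      A * (ENNReal.ofReal (t ^ 2) * T n ^ 2 + ENNReal.ofReal (t⁻¹ ^ 2) * S n ^ 2)) :
    Tendsto D atTop (𝓝 0) := by
  -- reduce to the two-index Cauchy form of the tree
  have hD' : ∀ t : ℝ, 0 < t → ∀ n m, D n ≤
      A * (ENNReal.ofReal (t ^ 2) * (T n + T m) ^ 2 + ENNReal.ofReal (t⁻¹ ^ 2) * K ^ 2) := by
    intro t ht n m
    refine (hD t ht n).trans ?_
    gcongr
    · exact le_self_add
    · exact hS n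
  have hC := cauchy_of_quadratic_bound (D := fun n _ => D n) hA (ENNReal.pow_ne_top hK) hT hD'
  rw [ENNReal.tendsto_atTop_zero]
  intro ε hε
  obtain ⟨N, hN⟩ := hC ε hε.ne'
  exact ⟨N, fun n hn => hN n hn n hn⟩

/-- **Normalised pressures of `L³`-close test fields are `L^{3/2}`-close**: if `aₙ`, `bₙ` are test
fields with `‖aₙ − bₙ‖_{L³} → 0` and `‖aₙ‖_{L³}, ‖bₙ‖_{L³} ≤ K < ∞`, then
`‖p̃[aₙ] − p̃[bₙ]‖_{L^{3/2}} → 0`. [folklore] -/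
theorem tendsto_eLpNorm_normalisedPressure_sub {a b : ℕ → ℝ³ → ℝ³}
    (ha : ∀ n, ContDiff ℝ (⊤ : ℕ∞) (a n) ∧ HasCompactSupport (a n))
    (hb : ∀ n, ContDiff ℝ (⊤ : ℕ∞) (b n) ∧ HasCompactSupport (b n)) {K : ℝ≥0∞} (hK : K ≠ ⊤)
    (haK : ∀ n, eLpNorm (a n) 3 volume ≤ K) (hbK : ∀ n, eLpNorm (b n) 3 volume ≤ K)
    (hT : Tendsto (fun n => eLpNorm (a n - b n) 3 volume) atTop (𝓝 0)) :
    Tendsto (fun n => eLpNorm (normalisedPressure (a n) - normalisedPressure (b n))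
      (3 / 2 : ℝ≥0∞) volume) atTop (𝓝 0) := by
  refine tendsto_zero_of_quadratic_bound (A := 4 * steinConstThreeHalves) (K := K + K)
    (S := fun n => eLpNorm (a n + b n) 3 volume)
    (ENNReal.mul_ne_top (by norm_num) ENNReal.coe_ne_top) (ENNReal.add_ne_top.2 ⟨hK, hK⟩) hT
    (fun n => ?_) fun t ht n => eLpNorm_normalisedPressure_sub_le_three (ha n).1 (ha n).2 (hb n).1
      (hb n).2 ht
  exact (eLpNorm_add_le (ha n).1.continuous.aestronglyMeasurable
    (hb n).1.continuous.aestronglyMeasurable (by norm_num)).trans (add_le_add (haK n) (hbK n))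

end Stein

/-! ## The `L³`-extension: Riesz pressures of an `L³` field -/

section Extension

/-- **`Q` is a Riesz pressure of the `L³` field `w`**: `w ∈ L³`, `Q ∈ L^{3/2}` and, along
EVERY sequence of test fields `vₙ → w` in `L³`, the normalised pressures
`p̃[vₙ] = -Δ⁻¹∂ᵢ∂ⱼ(vₙ,ᵢ vₙ,ⱼ)` (Tao's `normalisedPressure`) converge to `Q` in `L^{3/2}` — the
extension by continuity of `w ↦ -Δ⁻¹∂ᵢ∂ⱼ(wᵢwⱼ)` from test fields to `L³ → L^{3/2}` (Tsai 1998,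
proof of Lemma 2.1, p. 34: "We then extend this result to general `U ∈ L^q` by approximation";
Lemarié-Rieusset 2016, Prop. 6.2: the Leray projection on `L^p` through the Riesz transforms).
The first conjunct makes the predicate fail off `L³` (without it the `∀` would be vacuous
there). [cite: Tsai1998, Lemma 2.1 proof (p. 34)] -/
def IsRieszPressureOf (w : ℝ³ → ℝ³) (Q : ℝ³ → ℝ) : Prop :=
  MemLp w 3 volume ∧ MemLp Q (3 / 2 : ℝ≥0∞) volume ∧
    ∀ v : ℕ → ℝ³ → ℝ³, (∀ n, ContDiff ℝ (⊤ : ℕ∞) (v n) ∧ HasCompactSupport (v n)) →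
      Tendsto (fun n => eLpNorm (v n - w) 3 volume) atTop (𝓝 0) →
      Tendsto (fun n => eLpNorm (normalisedPressure (v n) - Q) (3 / 2 : ℝ≥0∞) volume) atTop (𝓝 0)

variable {w : ℝ³ → ℝ³} {Q Q₁ Q₂ : ℝ³ → ℝ}

/-- A Riesz pressure is in `L^{3/2}` (projection). [folklore] -/
theorem IsRieszPressureOf.memLp (h : IsRieszPressureOf w Q) : MemLp Q (3 / 2 : ℝ≥0∞) volume := h.2.1

/-- A field with a Riesz pressure is in `L³` (projection). [folklore] -/
theorem IsRieszPressureOf.memLp_field (h : IsRieszPressureOf w Q) : MemLp w 3 volume := h.1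

/-- Test-field approximants of an `L³` field are eventually within distance `1`, hence bounded in
`L³` by `1 + ‖w‖_{L³}` after a shift of the index. [folklore] -/
theorem exists_smooth_seq_tendsto_eLpNorm_three_bdd (hw : MemLp w 3 volume) :
    ∃ v : ℕ → ℝ³ → ℝ³, (∀ n, ContDiff ℝ (⊤ : ℕ∞) (v n) ∧ HasCompactSupport (v n)) ∧
      Tendsto (fun n => eLpNorm (v n - w) 3 volume) atTop (𝓝 0) ∧
      ∀ n, eLpNorm (v n) 3 volume ≤ 1 + eLpNorm w 3 volume := by
  obtain ⟨v₀, hv₀, hT₀⟩ := exists_smooth_seq_tendsto_eLpNorm_three hw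
  obtain ⟨N₀, hN₀⟩ := eventually_atTop.1 (hT₀.eventually (gt_mem_nhds zero_lt_one))
  refine ⟨fun n => v₀ (n + N₀), fun n => hv₀ (n + N₀), hT₀.comp (tendsto_add_atTop_nat N₀),
    fun n => ?_⟩
  have e : v₀ (n + N₀) = (v₀ (n + N₀) - w) + w := by abel
  calc eLpNorm (v₀ (n + N₀)) 3 volume = eLpNorm ((v₀ (n + N₀) - w) + w) 3 volume := by rw [← e]
    _ ≤ eLpNorm (v₀ (n + N₀) - w) 3 volume + eLpNorm w 3 volume :=
        eLpNorm_add_le ((hv₀ _).1.continuous.aestronglyMeasurable.sub hw.1) hw.1 (by norm_num)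
    _ ≤ 1 + eLpNorm w 3 volume := add_le_add (hN₀ (n + N₀) (Nat.le_add_left _ _)).le le_rfl

/-- **Stability along two approximating sequences**: if test fields `aₙ → w` and `bₙ → w` in
`L³` (`w ∈ L³`), then `‖p̃[aₙ] − p̃[bₙ]‖_{L^{3/2}} → 0`. [folklore] -/
theorem tendsto_eLpNorm_normalisedPressure_sub_of_tendsto (hw : MemLp w 3 volume)
    {a b : ℕ → ℝ³ → ℝ³} (ha : ∀ n, ContDiff ℝ (⊤ : ℕ∞) (a n) ∧ HasCompactSupport (a n))
    (hb : ∀ n, ContDiff ℝ (⊤ : ℕ∞) (b n) ∧ HasCompactSupport (b n))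
    (hTa : Tendsto (fun n => eLpNorm (a n - w) 3 volume) atTop (𝓝 0))
    (hTb : Tendsto (fun n => eLpNorm (b n - w) 3 volume) atTop (𝓝 0)) :
    Tendsto (fun n => eLpNorm (normalisedPressure (a n) - normalisedPressure (b n))
      (3 / 2 : ℝ≥0∞) volume) atTop (𝓝 0) := by
  -- after a shift both sequences are within `1` of `w`
  obtain ⟨Na, hNa⟩ := eventually_atTop.1 (hTa.eventually (gt_mem_nhds zero_lt_one))
  obtain ⟨Nb, hNb⟩ := eventually_atTop.1 (hTb.eventually (gt_mem_nhds zero_lt_one))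
  set N := max Na Nb with hN
  have ham : ∀ n, AEStronglyMeasurable (a n) volume := fun n => (ha n).1.continuous.aestronglyMeasurable
  have hbm : ∀ n, AEStronglyMeasurable (b n) volume := fun n => (hb n).1.continuous.aestronglyMeasurable
  have hbdd : ∀ (c : ℕ → ℝ³ → ℝ³), (∀ n, AEStronglyMeasurable (c n) volume) →
      (∀ n, N ≤ n → eLpNorm (c n - w) 3 volume < 1) →
      ∀ n, eLpNorm (c (n + N)) 3 volume ≤ 1 + eLpNorm w 3 volume := by
    intro c hcm hc n
    have e : c (n + N) = (c (n + N) - w) + w := by abel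
    calc eLpNorm (c (n + N)) 3 volume = eLpNorm ((c (n + N) - w) + w) 3 volume := by rw [← e]
      _ ≤ eLpNorm (c (n + N) - w) 3 volume + eLpNorm w 3 volume :=
          eLpNorm_add_le ((hcm _).sub hw.1) hw.1 (by norm_num)
      _ ≤ 1 + eLpNorm w 3 volume := add_le_add (hc (n + N) (Nat.le_add_left _ _)).le le_rfl
  have haK := hbdd a ham fun n hn => hNa n ((le_max_left _ _).trans hn)
  have hbK := hbdd b hbm fun n hn => hNb n ((le_max_right _ _).trans hn)
  have hK : 1 + eLpNorm w 3 volume ≠ ⊤ := ENNReal.add_ne_top.2 ⟨ENNReal.one_ne_top, hw.eLpNorm_ne_top⟩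
  -- `‖a_{n+N} − b_{n+N}‖ → 0`
  have hT : Tendsto (fun n => eLpNorm (a (n + N) - b (n + N)) 3 volume) atTop (𝓝 0) := by
    have hle : ∀ n, eLpNorm (a (n + N) - b (n + N)) 3 volume ≤
        eLpNorm (a (n + N) - w) 3 volume + eLpNorm (b (n + N) - w) 3 volume := fun n => by
      have e : a (n + N) - b (n + N) = (a (n + N) - w) + (w - b (n + N)) := by abel
      calc eLpNorm (a (n + N) - b (n + N)) 3 volume
          = eLpNorm ((a (n + N) - w) + (w - b (n + N))) 3 volume := by rw [← e]
        _ ≤ eLpNorm (a (n + N) - w) 3 volume + eLpNorm (w - b (n + N)) 3 volume :=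
            eLpNorm_add_le ((ham _).sub hw.1) (hw.1.sub (hbm _)) (by norm_num)
        _ = _ := by rw [eLpNorm_sub_comm w]
    have hlim := (hTa.comp (tendsto_add_atTop_nat N)).add (hTb.comp (tendsto_add_atTop_nat N))
    rw [add_zero] at hlim
    exact tendsto_of_tendsto_of_tendsto_of_le_of_le tendsto_const_nhds hlim (fun n => zero_le) hle
  have h := tendsto_eLpNorm_normalisedPressure_sub (fun n => ha (n + N)) (fun n => hb (n + N)) hK
    haK hbK hT
  exact (tendsto_add_atTop_iff_nat N).1 h

/-- **Existence of the Riesz pressure of an `L³` field** (Tsai 1998, proof of Lemma 2.1;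
Lemarié-Rieusset 2016, Prop. 6.2): along a sequence of test fields `vₙ → w` in `L³` the
normalised pressures `p̃[vₙ]` form a Cauchy sequence in `L^{3/2}` (bilinear estimate), whose limit
(completeness of `L^{3/2}`) is a Riesz pressure of `w` (any other approximating sequence has
`L^{3/2}`-close pressures). [cite: Tsai1998, Lemma 2.1 proof (p. 34)] -/
theorem exists_isRieszPressureOf (hw : MemLp w 3 volume) : ∃ Q, IsRieszPressureOf w Q := by
  obtain ⟨v, hv, hT, hvK⟩ := exists_smooth_seq_tendsto_eLpNorm_three_bdd hw
  have h1 : (1 : ℝ≥0∞) ≤ 3 / 2 :=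
    ((ENNReal.lt_div_iff_mul_lt (Or.inl (by norm_num)) (Or.inl (by norm_num))).2 (by norm_num)).le
  set P : ℕ → ℝ³ → ℝ := fun n => normalisedPressure (v n) with hP
  have hPmem : ∀ n, MemLp (P n) (3 / 2 : ℝ≥0∞) volume := fun n =>
    memLp_normalisedPressure_three_halves (hv n).1 (hv n).2
  have hK : 1 + eLpNorm w 3 volume ≠ ⊤ := ENNReal.add_ne_top.2 ⟨ENNReal.one_ne_top, hw.eLpNorm_ne_top⟩
  -- Cauchy in `L^{3/2}`
  set B : ℝ≥0∞ := ((1 + eLpNorm w 3 volume) + (1 + eLpNorm w 3 volume)) ^ 2 with hB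
  have hBtop : B ≠ ⊤ := ENNReal.pow_ne_top (ENNReal.add_ne_top.2 ⟨hK, hK⟩)
  have hvm : ∀ n, AEStronglyMeasurable (v n) volume := fun n => (hv n).1.continuous.aestronglyMeasurable
  have hD : ∀ t : ℝ, 0 < t → ∀ n m, eLpNorm (P n - P m) (3 / 2 : ℝ≥0∞) volume ≤
      4 * steinConstThreeHalves * (ENNReal.ofReal (t ^ 2) *
        (eLpNorm (v n - w) 3 volume + eLpNorm (v m - w) 3 volume) ^ 2 +
        ENNReal.ofReal (t⁻¹ ^ 2) * B) := by
    intro t ht n m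
    refine (eLpNorm_normalisedPressure_sub_le_three (hv n).1 (hv n).2 (hv m).1 (hv m).2 ht).trans ?_
    rw [hB]
    gcongr
    · have e : v n - v m = (v n - w) + (w - v m) := by abel
      calc eLpNorm (v n - v m) 3 volume = eLpNorm ((v n - w) + (w - v m)) 3 volume := by rw [← e]
        _ ≤ eLpNorm (v n - w) 3 volume + eLpNorm (w - v m) 3 volume :=
            eLpNorm_add_le ((hvm n).sub hw.1) (hw.1.sub (hvm m)) (by norm_num)
        _ = _ := by rw [eLpNorm_sub_comm w]
    · exact (eLpNorm_add_le (hvm n) (hvm m) (by norm_num)).trans (add_le_add (hvK n) (hvK m))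
  have hA : (4 : ℝ≥0∞) * steinConstThreeHalves ≠ ⊤ := ENNReal.mul_ne_top (by norm_num) ENNReal.coe_ne_top
  have hCauchy := cauchy_of_quadratic_bound hA hBtop hT hD
  obtain ⟨Q, hQmem, hE⟩ := exists_memLp_tendsto_eLpNorm_sub_of_cauchy h1 hPmem hCauchy
  refine ⟨Q, hw, hQmem, fun a ha hTa => ?_⟩
  -- any other approximating sequence
  have hstab := tendsto_eLpNorm_normalisedPressure_sub_of_tendsto hw ha hv hTa hT
  have hle : ∀ n, eLpNorm (normalisedPressure (a n) - Q) (3 / 2 : ℝ≥0∞) volume ≤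
      eLpNorm (normalisedPressure (a n) - P n) (3 / 2 : ℝ≥0∞) volume +
        eLpNorm (P n - Q) (3 / 2 : ℝ≥0∞) volume := fun n => by
    have e : normalisedPressure (a n) - Q = (normalisedPressure (a n) - P n) + (P n - Q) := by abel
    conv_lhs => rw [e]
    exact eLpNorm_add_le ((memLp_normalisedPressure_three_halves (ha n).1 (ha n).2).1.sub
      (hPmem n).1) ((hPmem n).1.sub hQmem.1) h1
  have hlim := hstab.add hE
  rw [add_zero] at hlim
  exact tendsto_of_tendsto_of_tendsto_of_le_of_le tendsto_const_nhds hlim (fun n => zero_le) hle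

/-- **Uniqueness**: two Riesz pressures of the same `L³` field agree a.e. [folklore] -/
theorem IsRieszPressureOf.ae_eq (h₁ : IsRieszPressureOf w Q₁) (h₂ : IsRieszPressureOf w Q₂) :
    Q₁ =ᵐ[volume] Q₂ := by
  obtain ⟨v, hv, hT⟩ := exists_smooth_seq_tendsto_eLpNorm_three h₁.1
  have h1 : (1 : ℝ≥0∞) ≤ 3 / 2 :=
    ((ENNReal.lt_div_iff_mul_lt (Or.inl (by norm_num)) (Or.inl (by norm_num))).2 (by norm_num)).le
  have hP : ∀ n, MemLp (normalisedPressure (v n)) (3 / 2 : ℝ≥0∞) volume := fun n =>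
    memLp_normalisedPressure_three_halves (hv n).1 (hv n).2
  have hle : ∀ n, eLpNorm (Q₁ - Q₂) (3 / 2 : ℝ≥0∞) volume ≤
      eLpNorm (normalisedPressure (v n) - Q₁) (3 / 2 : ℝ≥0∞) volume +
        eLpNorm (normalisedPressure (v n) - Q₂) (3 / 2 : ℝ≥0∞) volume := fun n => by
    have e : Q₁ - Q₂ = (Q₁ - normalisedPressure (v n)) + (normalisedPressure (v n) - Q₂) := by abel
    conv_lhs => rw [e]
    refine (eLpNorm_add_le (h₁.2.1.1.sub (hP n).1) ((hP n).1.sub h₂.2.1.1) h1).trans ?_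
    rw [eLpNorm_sub_comm]
  have hlim := (h₁.2.2 v hv hT).add (h₂.2.2 v hv hT)
  rw [add_zero] at hlim
  have h0 : eLpNorm (Q₁ - Q₂) (3 / 2 : ℝ≥0∞) volume = 0 :=
    le_antisymm (ge_of_tendsto' hlim hle) bot_le
  have h := (eLpNorm_eq_zero_iff (h₁.2.1.1.sub h₂.2.1.1) (by norm_num)).1 h0
  exact h.mono fun x hx => sub_eq_zero.1 hx

/-- A Riesz pressure of `w` is one of every field a.e. equal to `w` (the `L³` distances to the
test fields are unchanged). [folklore] -/
theorem IsRieszPressureOf.congr_ae {v : ℝ³ → ℝ³} (h : IsRieszPressureOf w Q) (hvw : v =ᵐ[volume] w) :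
    IsRieszPressureOf v Q := by
  refine ⟨h.1.ae_eq hvw.symm, h.2.1, fun a ha hT => h.2.2 a ha (hT.congr fun n => eLpNorm_congr_ae ?_)⟩
  exact EventuallyEq.rfl.sub hvw

open Classical in
/-- **The Riesz-transform pressure `Π[w] = -Δ⁻¹∂ᵢ∂ⱼ(wᵢwⱼ)` of a velocity field `w`** (the
pressure of the whole-space Navier–Stokes/Oseen equations, `∇p = -(Id - ℙ) div(w ⊗ w)` with
`ℙ = ℛ ∧ (ℛ ∧ ·)`, Lemarié-Rieusset 2016, Def. 6.9 and Prop. 6.2 — with `ℛⱼ = ∂ⱼ/√(-Δ)` this is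
`+Σᵢⱼ ℛᵢℛⱼ(wᵢwⱼ)`; Tao 2011, (35)): for `w ∈ L³` a chosen Riesz pressure of `w`
(`IsRieszPressureOf`, the `L^{3/2}`-limit of the normalised pressures of test fields
approximating `w` in `L³`; unique a.e., `IsRieszPressureOf.ae_eq`), and the junk value `0` when
`w ∉ L³` (then no `Q` is a Riesz pressure of `w`, `rieszPressure_eq_zero_of_not_memLp`). For test
fields it is a.e. the normalised pressure `p̃[w]` of `NormalisedPressure.lean`
(`rieszPressure_ae_eq_normalisedPressure`).
[cite: LemarieRieusset2016, Def. 6.9 with Prop. 6.2 (pp. 130, 136)] [cite: Tsai1998, Lemma 2.1 proof (p. 34)] -/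
def rieszPressure (w : ℝ³ → ℝ³) : ℝ³ → ℝ :=
  if h : ∃ Q, IsRieszPressureOf w Q then h.choose else 0

/-- For `w ∈ L³`, `Π[w]` is a Riesz pressure of `w`. [folklore] -/
theorem isRieszPressureOf_rieszPressure (hw : MemLp w 3 volume) :
    IsRieszPressureOf w (rieszPressure w) := by
  have hex : ∃ Q, IsRieszPressureOf w Q := exists_isRieszPressureOf hw
  rw [rieszPressure, dif_pos hex]
  exact hex.choose_spec

/-- Off `L³` the Riesz pressure is the junk value `0`. [folklore] -/
theorem rieszPressure_eq_zero_of_not_memLp (hw : ¬ MemLp w 3 volume) : rieszPressure w = 0 := by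
  have hex : ¬ ∃ Q, IsRieszPressureOf w Q := fun ⟨_, hQ⟩ => hw hQ.1
  rw [rieszPressure, dif_neg hex]

/-- `Π[w] ∈ L^{3/2}` for `w ∈ L³`. [cite: Stein1971, Ch. II §4.2 Thm. 3] -/
theorem memLp_rieszPressure (hw : MemLp w 3 volume) : MemLp (rieszPressure w) (3 / 2 : ℝ≥0∞) volume :=
  (isRieszPressureOf_rieszPressure hw).2.1

/-- `Π[w]` is a.e. strongly measurable for `w ∈ L³`. [folklore] -/
theorem aestronglyMeasurable_rieszPressure (hw : MemLp w 3 volume) :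
    AEStronglyMeasurable (rieszPressure w) volume :=
  (memLp_rieszPressure hw).1

/-- A.e. equal `L³` fields have a.e. equal Riesz pressures. [folklore] -/
theorem rieszPressure_congr_ae {v : ℝ³ → ℝ³} (hvw : v =ᵐ[volume] w) (hw : MemLp w 3 volume) :
    rieszPressure v =ᵐ[volume] rieszPressure w :=
  ((isRieszPressureOf_rieszPressure (hw.ae_eq hvw.symm)).congr_ae hvw.symm).ae_eq
    (isRieszPressureOf_rieszPressure hw)

/-- For a test field, `Π[w] = p̃[w]` a.e. (constant approximating sequence). [folklore] -/
theorem rieszPressure_ae_eq_normalisedPressure (hw : ContDiff ℝ (⊤ : ℕ∞) w) (hwc : HasCompactSupport w) :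
    rieszPressure w =ᵐ[volume] normalisedPressure w := by
  have hw3 : MemLp w 3 volume := hw.continuous.memLp_of_hasCompactSupport hwc
  have h := (isRieszPressureOf_rieszPressure hw3).2.2 (fun _ => w) (fun _ => ⟨hw, hwc⟩)
    (by simp)
  have h0 : eLpNorm (normalisedPressure w - rieszPressure w) (3 / 2 : ℝ≥0∞) volume = 0 :=
    tendsto_nhds_unique tendsto_const_nhds h
  have hm : AEStronglyMeasurable (normalisedPressure w - rieszPressure w) volume :=
    (memLp_normalisedPressure_three_halves hw hwc).1.sub (aestronglyMeasurable_rieszPressure hw3)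
  have h1 := (eLpNorm_eq_zero_iff hm (by norm_num)).1 h0
  exact h1.mono fun x hx => (sub_eq_zero.1 hx).symm

/-- **The `L^{3/2}` bound `‖Π[w]‖_{L^{3/2}} ≤ C_{3/2} ‖w‖²_{L³}`** (Stein's bound passed to the
limit). [cite: Stein1971, Ch. II §4.2 Thm. 3] -/
theorem eLpNorm_rieszPressure_le (hw : MemLp w 3 volume) :
    eLpNorm (rieszPressure w) (3 / 2 : ℝ≥0∞) volume ≤ steinConstThreeHalves * eLpNorm w 3 volume ^ 2 := by
  obtain ⟨v, hv, hT⟩ := exists_smooth_seq_tendsto_eLpNorm_three hw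
  have h1 : (1 : ℝ≥0∞) ≤ 3 / 2 :=
    ((ENNReal.lt_div_iff_mul_lt (Or.inl (by norm_num)) (Or.inl (by norm_num))).2 (by norm_num)).le
  have hR := isRieszPressureOf_rieszPressure hw
  have hE := hR.2.2 v hv hT
  have hP : ∀ n, MemLp (normalisedPressure (v n)) (3 / 2 : ℝ≥0∞) volume := fun n =>
    memLp_normalisedPressure_three_halves (hv n).1 (hv n).2
  have hvlim : Tendsto (fun n => eLpNorm (v n) 3 volume) atTop (𝓝 (eLpNorm w 3 volume)) :=
    tendsto_eLpNorm_of_tendsto_eLpNorm_sub (by norm_num)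
      (fun n => (hv n).1.continuous.aestronglyMeasurable) hw.1 hT
  have hstep : ∀ n, eLpNorm (rieszPressure w) (3 / 2 : ℝ≥0∞) volume ≤
      eLpNorm (normalisedPressure (v n) - rieszPressure w) (3 / 2 : ℝ≥0∞) volume +
        steinConstThreeHalves * eLpNorm (v n) 3 volume ^ 2 := fun n => by
    have e : rieszPressure w = (rieszPressure w - normalisedPressure (v n)) + normalisedPressure (v n) := by
      abel
    calc eLpNorm (rieszPressure w) (3 / 2 : ℝ≥0∞) volume
        = eLpNorm ((rieszPressure w - normalisedPressure (v n)) + normalisedPressure (v n))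
            (3 / 2 : ℝ≥0∞) volume := by rw [← e]
      _ ≤ eLpNorm (rieszPressure w - normalisedPressure (v n)) (3 / 2 : ℝ≥0∞) volume +
            eLpNorm (normalisedPressure (v n)) (3 / 2 : ℝ≥0∞) volume :=
          eLpNorm_add_le (hR.2.1.1.sub (hP n).1) (hP n).1 h1
      _ ≤ _ := by
          rw [eLpNorm_sub_comm]
          exact add_le_add le_rfl (eLpNorm_normalisedPressure_le_steinConst' (hv n).1 (hv n).2)
  have hlim : Tendsto (fun n => eLpNorm (normalisedPressure (v n) - rieszPressure w) (3 / 2 : ℝ≥0∞) volume +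
      steinConstThreeHalves * eLpNorm (v n) 3 volume ^ 2) atTop
      (𝓝 (0 + steinConstThreeHalves * eLpNorm w 3 volume ^ 2)) :=
    hE.add (ENNReal.Tendsto.const_mul (((ENNReal.continuous_pow 2).tendsto _).comp hvlim)
      (Or.inr ENNReal.coe_ne_top))
  have h := le_of_tendsto_of_tendsto' tendsto_const_nhds hlim hstep
  rwa [zero_add] at h

/-- **The bilinear estimate on `L³`**: for `v, w ∈ L³` and every `t > 0`,
`‖Π[v] − Π[w]‖_{L^{3/2}} ≤ 4 C_{3/2} (t² ‖v − w‖²_{L³} + t⁻² ‖v + w‖²_{L³})` (the test-field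
estimate passed to the limit). [cite: Tsai1998, Lemma 2.1 proof (p. 34)] -/
theorem eLpNorm_rieszPressure_sub_le {v : ℝ³ → ℝ³} (hv : MemLp v 3 volume) (hw : MemLp w 3 volume)
    {t : ℝ} (ht : 0 < t) :
    eLpNorm (rieszPressure v - rieszPressure w) (3 / 2 : ℝ≥0∞) volume ≤
      4 * steinConstThreeHalves * (ENNReal.ofReal (t ^ 2) * eLpNorm (v - w) 3 volume ^ 2 +
        ENNReal.ofReal (t⁻¹ ^ 2) * eLpNorm (v + w) 3 volume ^ 2) := by
  obtain ⟨a, ha, hTa⟩ := exists_smooth_seq_tendsto_eLpNorm_three hv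
  obtain ⟨b, hb, hTb⟩ := exists_smooth_seq_tendsto_eLpNorm_three hw
  have h1 : (1 : ℝ≥0∞) ≤ 3 / 2 :=
    ((ENNReal.lt_div_iff_mul_lt (Or.inl (by norm_num)) (Or.inl (by norm_num))).2 (by norm_num)).le
  have hRa := isRieszPressureOf_rieszPressure hv
  have hRb := isRieszPressureOf_rieszPressure hw
  have hEa := hRa.2.2 a ha hTa
  have hEb := hRb.2.2 b hb hTb
  have ham : ∀ n, AEStronglyMeasurable (a n) volume := fun n => (ha n).1.continuous.aestronglyMeasurable
  have hbm : ∀ n, AEStronglyMeasurable (b n) volume := fun n => (hb n).1.continuous.aestronglyMeasurable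
  have hPa : ∀ n, MemLp (normalisedPressure (a n)) (3 / 2 : ℝ≥0∞) volume := fun n =>
    memLp_normalisedPressure_three_halves (ha n).1 (ha n).2
  have hPb : ∀ n, MemLp (normalisedPressure (b n)) (3 / 2 : ℝ≥0∞) volume := fun n =>
    memLp_normalisedPressure_three_halves (hb n).1 (hb n).2
  -- norms of `aₙ - bₙ`, `aₙ + bₙ` converge to those of `v - w`, `v + w`
  have hTsub : Tendsto (fun n => eLpNorm ((a n - b n) - (v - w)) 3 volume) atTop (𝓝 0) := by
    have hle : ∀ n, eLpNorm ((a n - b n) - (v - w)) 3 volume ≤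
        eLpNorm (a n - v) 3 volume + eLpNorm (b n - w) 3 volume := fun n => by
      have e : (a n - b n) - (v - w) = (a n - v) - (b n - w) := by abel
      rw [e]
      exact eLpNorm_sub_le ((ham n).sub hv.1) ((hbm n).sub hw.1) (by norm_num)
    have hlim := hTa.add hTb
    rw [add_zero] at hlim
    exact tendsto_of_tendsto_of_tendsto_of_le_of_le tendsto_const_nhds hlim (fun n => zero_le) hle
  have hTadd : Tendsto (fun n => eLpNorm ((a n + b n) - (v + w)) 3 volume) atTop (𝓝 0) := by
    have hle : ∀ n, eLpNorm ((a n + b n) - (v + w)) 3 volume ≤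
        eLpNorm (a n - v) 3 volume + eLpNorm (b n - w) 3 volume := fun n => by
      have e : (a n + b n) - (v + w) = (a n - v) + (b n - w) := by abel
      rw [e]
      exact eLpNorm_add_le ((ham n).sub hv.1) ((hbm n).sub hw.1) (by norm_num)
    have hlim := hTa.add hTb
    rw [add_zero] at hlim
    exact tendsto_of_tendsto_of_tendsto_of_le_of_le tendsto_const_nhds hlim (fun n => zero_le) hle
  have hNsub : Tendsto (fun n => eLpNorm (a n - b n) 3 volume) atTop (𝓝 (eLpNorm (v - w) 3 volume)) :=
    tendsto_eLpNorm_of_tendsto_eLpNorm_sub (by norm_num) (fun n => (ham n).sub (hbm n)) (hv.1.sub hw.1) hTsub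
  have hNadd : Tendsto (fun n => eLpNorm (a n + b n) 3 volume) atTop (𝓝 (eLpNorm (v + w) 3 volume)) :=
    tendsto_eLpNorm_of_tendsto_eLpNorm_sub (by norm_num) (fun n => (ham n).add (hbm n)) (hv.1.add hw.1) hTadd
  -- the estimate for the test fields, plus the two `L^{3/2}` errors
  have hstep : ∀ n, eLpNorm (rieszPressure v - rieszPressure w) (3 / 2 : ℝ≥0∞) volume ≤
      (eLpNorm (normalisedPressure (a n) - rieszPressure v) (3 / 2 : ℝ≥0∞) volume +
        eLpNorm (normalisedPressure (b n) - rieszPressure w) (3 / 2 : ℝ≥0∞) volume) +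
      4 * steinConstThreeHalves * (ENNReal.ofReal (t ^ 2) * eLpNorm (a n - b n) 3 volume ^ 2 +
        ENNReal.ofReal (t⁻¹ ^ 2) * eLpNorm (a n + b n) 3 volume ^ 2) := fun n => by
    have e : rieszPressure v - rieszPressure w = ((rieszPressure v - normalisedPressure (a n)) -
        (rieszPressure w - normalisedPressure (b n))) +
        (normalisedPressure (a n) - normalisedPressure (b n)) := by abel
    calc eLpNorm (rieszPressure v - rieszPressure w) (3 / 2 : ℝ≥0∞) volume
        = eLpNorm (((rieszPressure v - normalisedPressure (a n)) -
            (rieszPressure w - normalisedPressure (b n))) +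
            (normalisedPressure (a n) - normalisedPressure (b n))) (3 / 2 : ℝ≥0∞) volume := by rw [← e]
      _ ≤ eLpNorm ((rieszPressure v - normalisedPressure (a n)) -
            (rieszPressure w - normalisedPressure (b n))) (3 / 2 : ℝ≥0∞) volume +
            eLpNorm (normalisedPressure (a n) - normalisedPressure (b n)) (3 / 2 : ℝ≥0∞) volume :=
          eLpNorm_add_le ((hRa.2.1.1.sub (hPa n).1).sub (hRb.2.1.1.sub (hPb n).1))
            ((hPa n).1.sub (hPb n).1) h1
      _ ≤ (eLpNorm (rieszPressure v - normalisedPressure (a n)) (3 / 2 : ℝ≥0∞) volume +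
            eLpNorm (rieszPressure w - normalisedPressure (b n)) (3 / 2 : ℝ≥0∞) volume) +
            4 * steinConstThreeHalves * (ENNReal.ofReal (t ^ 2) * eLpNorm (a n - b n) 3 volume ^ 2 +
              ENNReal.ofReal (t⁻¹ ^ 2) * eLpNorm (a n + b n) 3 volume ^ 2) :=
          add_le_add (eLpNorm_sub_le (hRa.2.1.1.sub (hPa n).1) (hRb.2.1.1.sub (hPb n).1) h1)
            (eLpNorm_normalisedPressure_sub_le_three (ha n).1 (ha n).2 (hb n).1 (hb n).2 ht)
      _ = _ := by rw [eLpNorm_sub_comm (rieszPressure v), eLpNorm_sub_comm (rieszPressure w)]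
  have hlim : Tendsto (fun n => (eLpNorm (normalisedPressure (a n) - rieszPressure v) (3 / 2 : ℝ≥0∞) volume +
        eLpNorm (normalisedPressure (b n) - rieszPressure w) (3 / 2 : ℝ≥0∞) volume) +
      4 * steinConstThreeHalves * (ENNReal.ofReal (t ^ 2) * eLpNorm (a n - b n) 3 volume ^ 2 +
        ENNReal.ofReal (t⁻¹ ^ 2) * eLpNorm (a n + b n) 3 volume ^ 2)) atTop
      (𝓝 ((0 + 0) + 4 * steinConstThreeHalves * (ENNReal.ofReal (t ^ 2) * eLpNorm (v - w) 3 volume ^ 2 +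
        ENNReal.ofReal (t⁻¹ ^ 2) * eLpNorm (v + w) 3 volume ^ 2))) := by
    refine (hEa.add hEb).add (ENNReal.Tendsto.const_mul ?_ (Or.inr ?_))
    · exact (ENNReal.Tendsto.const_mul (((ENNReal.continuous_pow 2).tendsto _).comp hNsub)
        (Or.inr ENNReal.ofReal_ne_top)).add (ENNReal.Tendsto.const_mul
        (((ENNReal.continuous_pow 2).tendsto _).comp hNadd) (Or.inr ENNReal.ofReal_ne_top))
    · exact ENNReal.mul_ne_top (by norm_num) ENNReal.coe_ne_top
  have h := le_of_tendsto_of_tendsto' tendsto_const_nhds hlim hstep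
  rwa [zero_add, zero_add] at h

/-- **Continuity of `Π` on `L³`**: if `vₙ → w` in `L³` (all in `L³`) then `Π[vₙ] → Π[w]` in
`L^{3/2}`. [cite: Tsai1998, Lemma 2.1 proof (p. 34)] -/
theorem tendsto_eLpNorm_rieszPressure_sub {v : ℕ → ℝ³ → ℝ³} (hv : ∀ n, MemLp (v n) 3 volume)
    (hw : MemLp w 3 volume) (hT : Tendsto (fun n => eLpNorm (v n - w) 3 volume) atTop (𝓝 0)) :
    Tendsto (fun n => eLpNorm (rieszPressure (v n) - rieszPressure w) (3 / 2 : ℝ≥0∞) volume)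
      atTop (𝓝 0) := by
  -- after a shift, `‖vₙ + w‖ ≤ ‖vₙ - w‖ + 2‖w‖ ≤ 1 + 2 ‖w‖`
  obtain ⟨N, hN⟩ := eventually_atTop.1 (hT.eventually (gt_mem_nhds zero_lt_one))
  have hK : 1 + 2 * eLpNorm w 3 volume ≠ ⊤ :=
    ENNReal.add_ne_top.2 ⟨ENNReal.one_ne_top, ENNReal.mul_ne_top (by norm_num) hw.eLpNorm_ne_top⟩
  have hS : ∀ n, eLpNorm (v (n + N) + w) 3 volume ≤ 1 + 2 * eLpNorm w 3 volume := fun n => by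
    have e : v (n + N) + w = (v (n + N) - w) + (w + w) := by abel
    calc eLpNorm (v (n + N) + w) 3 volume = eLpNorm ((v (n + N) - w) + (w + w)) 3 volume := by rw [← e]
      _ ≤ eLpNorm (v (n + N) - w) 3 volume + eLpNorm (w + w) 3 volume :=
          eLpNorm_add_le ((hv _).1.sub hw.1) (hw.1.add hw.1) (by norm_num)
      _ ≤ 1 + (eLpNorm w 3 volume + eLpNorm w 3 volume) :=
          add_le_add (hN (n + N) (Nat.le_add_left _ _)).le (eLpNorm_add_le hw.1 hw.1 (by norm_num))
      _ = 1 + 2 * eLpNorm w 3 volume := by rw [two_mul]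
  have h := tendsto_zero_of_quadratic_bound (D := fun n => eLpNorm (rieszPressure (v (n + N)) -
      rieszPressure w) (3 / 2 : ℝ≥0∞) volume) (T := fun n => eLpNorm (v (n + N) - w) 3 volume)
    (ENNReal.mul_ne_top (by norm_num) ENNReal.coe_ne_top) hK (hT.comp (tendsto_add_atTop_nat N)) hS
    fun t ht n => eLpNorm_rieszPressure_sub_le (hv (n + N)) hw ht
  exact (tendsto_add_atTop_iff_nat N).1 h

/-- **The weak pressure Poisson equation `Δ Π[w] = -∂ᵢ∂ⱼ(wᵢwⱼ)` for `w ∈ L³`**: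
`∫ Π[w] Δφ = -∫ D²φ(w, w)` for every test function `φ` (Tsai 1998, (2.5) "for general `U` by
approximation"; for test fields the tree's `integral_normalisedPressure_mul_laplacian`, then both
pairings pass to the `L³`/`L^{3/2}` limits). [cite: Tsai1998, (2.5) and Lemma 2.1 proof (p. 34)] -/
theorem integral_rieszPressure_mul_laplacian (hw : MemLp w 3 volume) {φ : ℝ³ → ℝ}
    (hφ : ContDiff ℝ (⊤ : ℕ∞) φ) (hφc : HasCompactSupport φ) :
    ∫ x, rieszPressure w x * (Δ φ) x = -∫ x, fderiv ℝ (fderiv ℝ φ) x (w x) (w x) := by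
  obtain ⟨v, hv, hT⟩ := exists_smooth_seq_tendsto_eLpNorm_three hw
  have hR := isRieszPressureOf_rieszPressure hw
  have hE := hR.2.2 v hv hT
  have hP : ∀ n, MemLp (normalisedPressure (v n)) (3 / 2 : ℝ≥0∞) volume := fun n =>
    memLp_normalisedPressure_three_halves (hv n).1 (hv n).2
  have hφ2 : ContDiff ℝ 2 φ := contDiff_infty.1 hφ 2
  have hΔc : Continuous (Δ φ) := FluidPDE.continuous_laplacian hφ2
  have hΔs : HasCompactSupport (Δ φ) :=
    hφc.mono' fun x hx => by
      contrapose! hx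
      simp [FluidPDE.laplacian_eq_zero_of_notMem_tsupport hx]
  have hΔ3 : MemLp (Δ φ) 3 volume := hΔc.memLp_of_hasCompactSupport hΔs
  -- the two limits
  haveI : ENNReal.HolderTriple (3 / 2) 3 1 := by
    have h23 : (2 : ℝ≥0∞) / 3 + 3⁻¹ = 1 := by
      rw [show (3 : ℝ≥0∞)⁻¹ = 1 / 3 by rw [one_div], ENNReal.div_add_div_same,
        show (2 : ℝ≥0∞) + 1 = 3 by norm_num]
      exact ENNReal.div_self (by norm_num) (by norm_num)
    constructor
    rw [ENNReal.inv_div (Or.inr (by norm_num)) (Or.inr (by norm_num)), inv_one, h23]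
  have h1 : Tendsto (fun n => ∫ x, normalisedPressure (v n) x * (Δ φ) x) atTop
      (𝓝 (∫ x, rieszPressure w x * (Δ φ) x)) :=
    tendsto_integral_mul_of_tendsto_eLpNorm_sub hP (memLp_rieszPressure hw) hE hΔ3
  have h2 : Tendsto (fun n => ∫ x, normalisedPressure (v n) x * (Δ φ) x) atTop
      (𝓝 (-∫ x, fderiv ℝ (fderiv ℝ φ) x (w x) (w x))) := by
    have h := (tendsto_integral_hessian_apply_of_tendsto_eLpNorm
      (fun n => (hv n).1.continuous.memLp_of_hasCompactSupport (hv n).2) hw hT hφ hφc).neg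
    refine h.congr fun n => ?_
    exact (integral_normalisedPressure_mul_laplacian_eq_neg (hv n).1 (hv n).2 hφ hφc).symm
  exact tendsto_nhds_unique h1 h2

end Extension

end Literature.Analysis.FluidPDE
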